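/-
Copyright: lit-balaban Phase-2 proof seat p27 (gen 32).  Statement-level skeleton of a published paper; no proof claims beyond what the
kernel checks below.
-/
import Literature.MathematicalPhysics.QuantumFieldTheory.BalabanImbrieJaffe1984to88.BIJ85FreeResolventTiltedRow
import Literature.MathematicalPhysics.QuantumFieldTheory.BalabanImbrieJaffe1984to88.BIJ88NeumannPropagatorWholeTorus

/-!
# [BalabanImbrieJaffe1985] §7.3, p. 326 — **THE SUP-NORM DECAY OF THE COVARIANT BLOCK PROPAGATOR `G_k(u) = [D_u^*D_u + a_kQ_k(u)^*Q_k(u)]⁻¹`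
# AT NON-FLAT SMALL FIELDS, `k`-UNIFORM** ([7]'s (1.10), value member, for p31's torus propagator of record `gBox (α_kL^{kd}) ε⁻¹ u k T`;
# `d ≤ 3`), kernel file 3 of 3: Kato's inequality, the covariant block term, the Agmon gap, the assembly
# v1.1 (§5): the bound in the binder shape of p31's displayed hypothesis (H1.10) of `BIJ88DeltaLocClose235General` for the OUTER region
# `X = T` (`decay110_smallField_input`)

T. Bałaban, J. Imbrie, A. Jaffe, *Renormalization of the Higgs model: minimizers, propagators and the stability of mean field theory*,
Commun. Math. Phys. **97** (1985) 299–329 [BalabanImbrieJaffe1985], §7.3 p. 326 [PDF 28], (4.6.2)–(4.6.3) p. 313 [PDF 15], (2.6) p. 303;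
[7] there = [Balaban1983RegularityDecay], Commun. Math. Phys. **89** (1983) 571–597, (1.10) p. 573.

statement-level skeleton of published theorems with citation tags; proofs where landed; nothing here is a claim about the Yang–Mills mass gap

PDF held: `paper:balaban1985-cmp97-bij-higgs-minimizers` (p. 326 = PDF 28, p. 313 = PDF 15); text layer of p. 326 and p. 313 re-read this
session (`lit read … --pages 28`, `--pages 15`).

CITATION HEADER (lean-in-tree rule).  Part of the lit-balaban TYPED SKELETON (HOME `run/shared/lean/pub/lit-balaban/`), PHASE-2 proof seat
p27 gen 32 (unit `lit-balaban-p27-g32`; TAKING line HOME/STATUS.md 2026-08-22T19:09:49Z; free-target protocol G.5-34(d) — item 3 of the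
owner's `HOME/lit-balaban-r15/C1-CLOSURE.md` §5 (owner r15, referee ref-5): *"a small-field (non-flat u_k) SUP-NORM decay member of the p. 326
propagator sentence in [6]'s (1.9)/(1.10) shape (p31 g16 `BIJ88NeumannPropagatorFlatDecay` p330033 is the flat template; p33's Agmon members
p307418/p309167 are L²-pairing decay) — member of C1.Eq7.3.1-7.3.2, no head effect"*).  WHAT IS REPRODUCED: the SUP-NORM (value) member of
the decay sentence of [BalabanImbrieJaffe1985] p. 326 — row **C1.Eq7.3.1-7.3.2** of `HOME/lit-balaban-r15/ROWS-C1.md` (owner r15), a located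
member of that row (no head effect) — for the WHOLE-TORUS covariant block propagator at every `U(1)` background obeying p33's block-scale
plaquette smallness, in [7]'s (1.10) shape; the flat (`u = 1^h`) case is p31's `BIJ88NeumannPropagatorFlatDecay.decay110_flat`, the
`L²`-pairing member is p33's `BIJ85ScalarPropagatorDecay.decay_pairing_dist`.  Kind «model-level theorems only» (no new definition, no
`Prop`-valued fact introduced).

THE PRINTED TEXT (verbatim).  p. 326 [PDF 28]: *"These inequalities can be proved by an extension of the proofs of [7]. The propagators
arising from Δ_k(u_k), under the restriction (7.3.1) on the gauge field, also satisfy the regularity and decay estimates of [7]. In order to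
remain within the framework of this reference, we remark that by change of gauge u_k can be transformed in a local region Λ into a
configuration of the form exp[ie_kηA], where A is smooth and small."*  p. 313 [PDF 15]: *"G_k(u_k) = [−Δ_{u_k} + a_kQ_k^*(u_k)Q_k(u_k)]^{−1},
(4.6.2) where −Δ_{u_k} = D^*_{u_k}D_{u_k}. (4.6.3)"*.  [7] (1.10) p. 573 (as transcribed in the tree's `Balaban1983to89.B4Thm110ZeroTorus`):
*"|(D^η_{A,μ}G_k(Ω, A)f)(x)|, |(G_k(Ω, A)f)(x)| ≤ c₀exp(−δ₀ dist(x, supp f))‖f‖_∞ (1.10)"*.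

THE OBJECT.  `G_k(T,u) = BIJ88NeumannPropagator227Torus.gBox (α_kL^{kd}) ε⁻¹ U k univ` (p31 gen 15/16): the inverse on `ℓ²(T^{(0)})` of
`nOp (α_kL^{kd}) ε⁻¹ U k univ = (χ_TD_u)ᴴ(χ_TD_u) + α_kL^{kd}·(Q_k(u)|_T)ᴴ(Q_k(u)|_T)` (`nOp_eq`), `α_k = a_k(L^kε)^{−2}` = pv07's
`B1RG242Torus.α P a k`, `Q_k(u)` with the entries `L^{−kd}u(Γ^{(k)}_{yx})` of (2.6) (`qMatK_apply`), `D_u` the covariant derivative of scale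
`ε⁻¹` over all bonds of the fine torus (`dN_univ_apply`); at `u = 1` this is `((tower P a 0).G k).map ofReal` (p31 `gBox_flat_eq_tower`).
It is p11's `G_k(u)` of (4.6.2) on the torus (`BIJ88NeumannPropagatorWholeTorus.opT_gLin`, `eq_gLin`).

THE MECHANISM (DIVERGENCE OF METHOD from the printed route — [7]'s random-walk expansion after a local change of gauge to a small smooth `A` —
disclosed; same SHAPE of statement, the (1.10) VALUE member; the route is gauge-blind, so no gauge fixing is used and the flux sectors of
p33's `BIJ85FluxSectors731`, where no global small gauge exists, are covered).  `φ = G_k(T,u)f`, `m = (L^kε)^{−2}`, `v = |φ|`.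
(§1) THE COVARIANT LAPLACIAN ENTRYWISE (`gram_dN_mulVec_apply`) and **KATO'S INEQUALITY** `((−Δ^ε + m)v)(x) ≤ |((D_u^*D_u + m)φ)(x)|`
(`kato_pointwise`; `|u_b| = 1`).  (§2) `|(Q_k(u)ᴴQ_k(u)φ)(x)| ≤ L^{−kd}(Q_k^*Q_kv)(x)` (`norm_gram_qMatK_mulVec_le`; `|u(Γ)| = 1`), so with the
equation `D_u^*D_uφ = f − α_kL^{kd}Q_k(u)ᴴQ_k(u)φ`: `((−Δ^ε + m)v)(x) ≤ g(x) := |f(x)| + α_k(Q_k^*Q_kv)(x) + mv(x)` and, by the comparison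
principle of file 1, `v(x) ≤ (Rg)(x) = Σ_zR(x,z)g(z)`, `R = (−Δ^ε + m)⁻¹ ≥ 0`.  (§4) CAUCHY–SCHWARZ with `w = e^{t|x−·|_∞/L^k}`, `ω = w⁻¹`:
`v(x)² ≤ [Σ_z(wR(x,·))²]·[Σ_z(ωg)²]`; the first factor is `≤ C₀(L^kε)⁴L^{−kd}` (file 2 `tilted_row_R_sq_le`, `d ≤ 3`); in the second,
`Σ(ωg)² ≤ 3(B + α_k²A_Q + m²A)` with `B = Σ(ω|f|)² ≤ F²e^{−tD/L^k}K_tL^{kd}` (support and radial sum), `A_Q = Σ(ωQ_k^*Q_kv)² ≤ e^{2t}A` (file 1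
`tilted_sq_QQ_le`) and `A = Σ(ωv)² ≤ (2(L^kε)²/μ₀)²B` — p33's **`BIJ85ScalarPropagatorDecay.agmon_weighted`** for the inverse `gLin` of p11's
operator with the `x`-CENTRED weight `ω` (bond oscillation `S₁ = (t/L^k)²e^{t/L^k}`, block oscillation `S₂ = t²e^t`) and the gap
`m₀ − κ(t) ≥ μ₀/(2(L^kε)²)`, `μ₀ = min(a/4, 1/4)`, for `t ≤ min(1, μ₀/((4d + a)e))` (§3 `agmon_gap`, using `a/2 ≤ a_k ≤ a`).  The scalar
bookkeeping `α_k(L^kε)² = a_k`, `m(L^kε)² = 1` (§3 `assembly_arith`) gives **`|φ(x)| ≤ c₀(L^kε)²e^{−(t/2)D/L^k}F`**, `c₀ = √(C₀C₂K_t)`,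
`C₂ = 3(1 + 4(a²e² + 1)/μ₀²)`, `K_t = (2(1 + d/t))^d`.

WHAT IS PROVED (theorems only; 0 `sorry`; standard axioms; no new definition, no `Prop`-valued fact).
* §1 (private) `sum_bond_ite_src`, `sum_bond_ite_tgt`; **`gram_dN_mulVec_apply`** (`((D_uᴴD_u)φ)(x) = ε^{−2}Σ_μ((φ(x) − u_{⟨x,μ⟩}φ(x+e_μ)) + (φ(x) −
  ū_{⟨x−e_μ,μ⟩}φ(x−e_μ)))`), **`kato_pointwise`**.
* §2 **`norm_gram_qMatK_mulVec_le`**.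
* §3 `aSeq_ge_half`, **`agmon_gap`**, (private) `assembly_arith`.
* §4 **`decay110_smallField`**: for `1 ≤ d ≤ 3`, `L` odd `> 1`, `a > 0`: `∃ t₀ c₀ > 0` such that for every volume `P` (`P.d = d`, `P.L = L`),
  every `1 ≤ k ≤ K`, every `U : GaugeField P 0 U1` and `θ` with `‖u(∂p) − 1‖ ≤ θ` at every plaquette and `2d³((L^k)²θ)² ≤ 1`, every `x`, every
  `f` with `‖f‖ ≤ F` and `f(z) ≠ 0 → D ≤ |x−z|_∞`: `‖(G_k(T,u)f)(x)‖ ≤ c₀(L^kε)²e^{−t₀D/L^k}F`; **`decay110_smallField_T`** — the same in p31's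
  (1.10) shape (`0 ≤ D` measured by `B5Ineq137Torus.T`, bound `c₀e^{−t₀εD}F`, using `L^kε ≤ 1`); **`decay110_smallField_kernel`** —
  `‖G_k(T,u)(x,y)‖ ≤ c₀(L^kε)²e^{−t₀|x−y|_∞/L^k}`.
* §5 (v1.1) **`decay110_smallField_input`** — `decay110_smallField` in the binder shape of p31's displayed hypothesis (H1.10) of
  `BIJ88DeltaLocClose235General` for the outer region `X = T` (`B5Ineq137Torus.T`, `(L^kε)²·(c₀e^{−δ₀(L^k)^{−1}D}F)`).

HONEST SCOPE.  The VALUE member of (1.10) only: no covariant-derivative member `|(D_{u,μ}G_kf)(x)|`, no Hölder member (1.9), no `L²`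
regularity statements; `d ≤ 3` (the tilted row bound of file 2); the WHOLE torus `Ω = T` only (no Neumann sub-domains `G_k(Λ,u)`); the
smallness hypothesis is p33's block-scale plaquette condition `2d³(L^{2k}θ)² ≤ 1` on `|u(∂p) − 1| ≤ θ` — that (7.3.1) at `e_k` small implies
it for the background of record is p33's `BIJ85Claim73PropagatorDecay`, not restated here; decay rate `t₀` and constant `c₀` ours (explicit,
depending on `d, L, a` only), in the block scale `L^k` (lattice units), which is [7]'s `ξ`-distance.  DIVERGENCE OF METHOD as stated.  Nothing
here is summit progress.  Unit `lit-balaban-p27` (literature-prover-lit-balaban-p27-g32-0), HOME `run/shared/lean/pub/lit-balaban/`,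
2026-08-22.
-/

open scoped BigOperators ComplexConjugate
open Finset Matrix

namespace Literature.MathematicalPhysics.QuantumFieldTheory.BalabanImbrieJaffe1984to88.BIJ85ScalarPropagatorSupDecay

open Literature.MathematicalPhysics.QuantumFieldTheory.Balaban1983to89
open B1RG242Torus (H tower)
open LatticeFieldCalculus (supDist)
open BIJ88Sect3Statements (U1 toC cfg covD norm_toC)
open BIJ85BlockAveragesTorus BIJ85BlockAveragesTorusK
open BIJ88NeumannPropagator227Torus (nOp gBox dN qMatK nOp_eq gBox_univ_mul qMatK_apply qMatK_mulVec conj_mul_toC)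
open BIJ88NeumannPropagatorFlatDecay (dN_univ_apply)
open BIJ88NeumannPropagatorWholeTorus (gLin ofLp_gLin opT_gLin)
open BIJ85ScalarPropagatorTorus (FineSp)
open BIJ85AgmonDefect (wmul norm_wmul_sq sq_exp_sub_exp_le_of_abs_le)
open BIJ85AbelianStokes (plaqC)
open BIJ85FreeResolventTorus BIJ85FreeResolventTiltedRow

noncomputable section

variable {P : Params}

/-! ## §1 Kato's inequality for the covariant Laplacian `D_u^*D_u` on the torus (pointwise, gauge-blind) -/

/-- kernel: a bond sum against the indicator `[x = b₋]` is the sum over the `d` bonds leaving `x`. [folklore] -/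
private theorem sum_bond_ite_src {α : Type*} [AddCommMonoid α] (x : Balaban1983to89.Site P 0) (F : PBond P 0 → α) :
    ∑ b : PBond P 0, (if x = b.src then F b else 0) = ∑ μ : Fin P.d, F ⟨x, μ⟩ := by
  rw [BIJ85BlockAveragingIneq.sum_bond_eq]
  have key : ∀ z : Balaban1983to89.Site P 0, ∑ μ : Fin P.d, (if x = (⟨z, μ⟩ : PBond P 0).src then F ⟨z, μ⟩ else 0) =
      if x = z then ∑ μ : Fin P.d, F ⟨z, μ⟩ else 0 := by
    intro z
    by_cases h : x = z
    · simp only [h, if_true]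
    · simp only [show ¬ (x = (z : Balaban1983to89.Site P 0)) from h, if_false, sum_const_zero]
  simp_rw [key]
  rw [sum_ite_eq univ x, if_pos (mem_univ _)]

/-- kernel: a bond sum against the indicator `[x = b₊]` is the sum over the `d` bonds arriving at `x`. [folklore] -/
private theorem sum_bond_ite_tgt {α : Type*} [AddCommMonoid α] (x : Balaban1983to89.Site P 0) (F : PBond P 0 → α) :
    ∑ b : PBond P 0, (if x = b.tgt then F b else 0) = ∑ μ : Fin P.d, F ⟨x.unshift μ, μ⟩ := by
  rw [BIJ85BlockAveragingIneq.sum_bond_eq, sum_comm]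
  refine sum_congr rfl fun μ _ => ?_
  have key : ∀ z : Balaban1983to89.Site P 0, (if x = (⟨z, μ⟩ : PBond P 0).tgt then F ⟨z, μ⟩ else 0) =
      if z = x.unshift μ then F ⟨z, μ⟩ else 0 := by
    intro z
    have e : (x = (⟨z, μ⟩ : PBond P 0).tgt) ↔ (z = x.unshift μ) := by
      show x = z.shift μ ↔ z = x.unshift μ
      constructor
      · rintro rfl; exact ((LatticeFieldCalculus.shiftEquiv μ).left_inv z).symm
      · rintro rfl; exact ((LatticeFieldCalculus.shiftEquiv μ).right_inv x).symm
    by_cases h : z = x.unshift μ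
    · rw [if_pos (e.2 h), if_pos h]
    · rw [if_neg (fun h' => h (e.1 h')), if_neg h]
  simp_rw [key]
  rw [sum_ite_eq' univ, if_pos (mem_univ _)]

/-- **THE COVARIANT LAPLACIAN ENTRYWISE**: `((D_uᴴD_u)φ)(x) = c²Σ_μ((φ(x) − u_{⟨x,μ⟩}φ(x+e_μ)) + (φ(x) − ū_{⟨x−e_μ,μ⟩}φ(x−e_μ)))` for the whole-torus
Neumann derivative `χ_TD_u = D_u` of (4.6.3) (`|u_b| = 1`). [cite: BalabanImbrieJaffe1985, (4.6.3) p.313] -/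
theorem gram_dN_mulVec_apply (c : ℝ) (U : GaugeField P 0 U1) (φ : Balaban1983to89.Site P 0 → ℂ) (x : Balaban1983to89.Site P 0) :
    (((dN c U univ)ᴴ * dN c U univ) *ᵥ φ) x =
      (c : ℂ) ^ 2 * ∑ μ : Fin P.d, ((φ x - cfg U ⟨x, μ⟩ * φ (x.shift μ)) +
        (φ x - conj (cfg U ⟨x.unshift μ, μ⟩) * φ (x.unshift μ))) := by
  rw [← mulVec_mulVec, mulVec, dotProduct]
  simp_rw [conjTranspose_apply, BIJ88NeumannPropagator227Torus.dN_mulVec, dN_univ_apply]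
  have hb : ∀ b : PBond P 0, b ∈ BIJ88Sect3Statements.starB (univ : Finset (Balaban1983to89.Site P 0)) := fun b =>
    (BIJ88Sect3Statements.mem_starB _ _).2 ⟨mem_univ _, mem_univ _⟩
  simp_rw [if_pos (hb _)]
  -- split each bond term into its `[x = b₊]` and `[x = b₋]` parts
  have hterm : ∀ b : PBond P 0,
      star ((c : ℂ) * (if x = b.tgt then cfg U b else 0) - (c : ℂ) * (if x = b.src then 1 else 0)) * covD c (cfg U) φ b =
        (if x = b.tgt then (c : ℂ) ^ 2 * (φ x - conj (cfg U b) * φ b.src) else 0) +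
          (if x = b.src then (c : ℂ) ^ 2 * (φ x - cfg U b * φ b.tgt) else 0) := by
    intro b
    have hu : conj (cfg U b) * cfg U b = 1 := conj_mul_toC (U b)
    have hstar : star ((c : ℂ) * (if x = b.tgt then cfg U b else 0) - (c : ℂ) * (if x = b.src then 1 else 0)) =
        (c : ℂ) * (if x = b.tgt then conj (cfg U b) else 0) - (c : ℂ) * (if x = b.src then 1 else 0) := by
      rw [Complex.star_def, map_sub, map_mul, map_mul, Complex.conj_ofReal]
      congr 2
      · split_ifs <;> simp
      · split_ifs <;> simp
    rw [hstar]
    unfold covD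
    by_cases h1 : x = b.tgt
    · by_cases h2 : x = b.src
      · rw [if_pos h1, if_pos h2, if_pos h1, if_pos h2, ← h1, ← h2]
        linear_combination ((c : ℂ) ^ 2 * φ x) * hu
      · rw [if_pos h1, if_neg h2, if_pos h1, if_neg h2, ← h1]
        linear_combination ((c : ℂ) ^ 2 * φ x) * hu
    · by_cases h2 : x = b.src
      · rw [if_neg h1, if_pos h2, if_neg h1, if_pos h2, ← h2]
        ring
      · rw [if_neg h1, if_neg h2, if_neg h1, if_neg h2]
        ring
  simp_rw [hterm]
  rw [sum_add_distrib, sum_bond_ite_tgt, sum_bond_ite_src, mul_sum, ← sum_add_distrib]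
  refine sum_congr rfl fun μ _ => ?_
  show (c : ℂ) ^ 2 * (φ x - conj (cfg U ⟨x.unshift μ, μ⟩) * φ (x.unshift μ)) +
      (c : ℂ) ^ 2 * (φ x - cfg U ⟨x, μ⟩ * φ (x.shift μ)) =
    (c : ℂ) ^ 2 * ((φ x - cfg U ⟨x, μ⟩ * φ (x.shift μ)) + (φ x - conj (cfg U ⟨x.unshift μ, μ⟩) * φ (x.unshift μ)))
  ring


/-- **KATO'S INEQUALITY (diamagnetic domination) for `D_u^*D_u`, pointwise**: for `m ≥ 0` and every complex field `φ`,
`((−Δ^ε + m)|φ|)(x) ≤ |((D_u^*D_u + m)φ)(x)|` — the free massive Laplacian of `|φ|` is dominated entrywise by the covariant one (`|u_b| = 1`;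
gauge-blind). This replaces the random-walk expansion *"by an extension of the proofs of [7]"* of p. 326 in the sup-norm step.
[cite: BalabanImbrieJaffe1985, (4.6.3) p.313] -/
theorem kato_pointwise {m : ℝ} (hm : 0 ≤ m) (U : GaugeField P 0 U1) (φ : Balaban1983to89.Site P 0 → ℂ) (x : Balaban1983to89.Site P 0) :
    (H P m *ᵥ fun z => ‖φ z‖) x ≤ ‖(((dN P.eps⁻¹ U univ)ᴴ * dN P.eps⁻¹ U univ) *ᵥ φ) x + (m : ℂ) * φ x‖ := by
  rw [H_mulVec_apply, gram_dN_mulVec_apply]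
  show m * ‖φ x‖ + ∑ μ : Fin P.d, (P.eps⁻¹) ^ 2 * ((‖φ x‖ - ‖φ (x.shift μ)‖) + (‖φ x‖ - ‖φ (x.unshift μ)‖)) ≤ _
  have hc0 : 0 ≤ P.eps⁻¹ := inv_nonneg.2 P.eps_pos.le
  have hM : 0 ≤ m + 2 * P.d * (P.eps⁻¹) ^ 2 := by positivity
  -- the complex side: `c²Σ_μ((φ − uφ₊) + (φ − ū₋φ₋)) + mφ = (m + 2dc²)φ(x) − c²Σ_μ(uφ₊ + ū₋φ₋)`
  have key : ((P.eps⁻¹ : ℝ) : ℂ) ^ 2 * ∑ μ : Fin P.d, ((φ x - cfg U ⟨x, μ⟩ * φ (x.shift μ)) +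
        (φ x - conj (cfg U ⟨x.unshift μ, μ⟩) * φ (x.unshift μ))) + (m : ℂ) * φ x =
      ((m + 2 * P.d * (P.eps⁻¹) ^ 2 : ℝ) : ℂ) * φ x -
        ((P.eps⁻¹ : ℝ) : ℂ) ^ 2 * ∑ μ : Fin P.d, (cfg U ⟨x, μ⟩ * φ (x.shift μ) + conj (cfg U ⟨x.unshift μ, μ⟩) * φ (x.unshift μ)) := by
    have hs : ∑ μ : Fin P.d, ((φ x - cfg U ⟨x, μ⟩ * φ (x.shift μ)) + (φ x - conj (cfg U ⟨x.unshift μ, μ⟩) * φ (x.unshift μ))) =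
        ∑ μ : Fin P.d, (2 * φ x - (cfg U ⟨x, μ⟩ * φ (x.shift μ) + conj (cfg U ⟨x.unshift μ, μ⟩) * φ (x.unshift μ))) :=
      sum_congr rfl fun μ _ => by ring
    rw [hs, sum_sub_distrib, sum_const, card_univ, Fintype.card_fin, nsmul_eq_mul]
    push_cast
    ring
  -- the real side: `m|φ| + c²Σ_μ((|φ| − |φ₊|) + (|φ| − |φ₋|)) = (m + 2dc²)|φ(x)| − c²Σ_μ(|φ₊| + |φ₋|)`
  have keyR : m * ‖φ x‖ + ∑ μ : Fin P.d, (P.eps⁻¹) ^ 2 * ((‖φ x‖ - ‖φ (x.shift μ)‖) + (‖φ x‖ - ‖φ (x.unshift μ)‖)) =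
      (m + 2 * P.d * (P.eps⁻¹) ^ 2) * ‖φ x‖ - (P.eps⁻¹) ^ 2 * ∑ μ : Fin P.d, (‖φ (x.shift μ)‖ + ‖φ (x.unshift μ)‖) := by
    have hs : ∑ μ : Fin P.d, (P.eps⁻¹) ^ 2 * ((‖φ x‖ - ‖φ (x.shift μ)‖) + (‖φ x‖ - ‖φ (x.unshift μ)‖)) =
        ∑ μ : Fin P.d, ((P.eps⁻¹) ^ 2 * (2 * ‖φ x‖) - (P.eps⁻¹) ^ 2 * (‖φ (x.shift μ)‖ + ‖φ (x.unshift μ)‖)) :=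
      sum_congr rfl fun μ _ => by ring
    rw [hs, sum_sub_distrib, sum_const, card_univ, Fintype.card_fin, nsmul_eq_mul, ← mul_sum]
    ring
  rw [key, keyR]
  have h1 : ‖((m + 2 * P.d * (P.eps⁻¹) ^ 2 : ℝ) : ℂ) * φ x‖ = (m + 2 * P.d * (P.eps⁻¹) ^ 2) * ‖φ x‖ := by
    rw [norm_mul, Complex.norm_real, Real.norm_of_nonneg hM]
  have h2 : ‖((P.eps⁻¹ : ℝ) : ℂ) ^ 2 *
        ∑ μ : Fin P.d, (cfg U ⟨x, μ⟩ * φ (x.shift μ) + conj (cfg U ⟨x.unshift μ, μ⟩) * φ (x.unshift μ))‖ ≤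
      (P.eps⁻¹) ^ 2 * ∑ μ : Fin P.d, (‖φ (x.shift μ)‖ + ‖φ (x.unshift μ)‖) := by
    rw [norm_mul, norm_pow, Complex.norm_real, Real.norm_of_nonneg hc0]
    refine mul_le_mul_of_nonneg_left ((norm_sum_le _ _).trans (sum_le_sum fun μ _ => ?_)) (by positivity)
    refine (norm_add_le _ _).trans (le_of_eq ?_)
    have hu1 : ‖cfg U ⟨x, μ⟩‖ = 1 := norm_toC (U ⟨x, μ⟩)
    have hu2 : ‖cfg U ⟨x.unshift μ, μ⟩‖ = 1 := norm_toC (U ⟨x.unshift μ, μ⟩)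
    rw [norm_mul, norm_mul, RCLike.norm_conj, hu1, hu2, one_mul, one_mul]
  have h3 := norm_sub_norm_le (((m + 2 * P.d * (P.eps⁻¹) ^ 2 : ℝ) : ℂ) * φ x)
    (((P.eps⁻¹ : ℝ) : ℂ) ^ 2 * ∑ μ : Fin P.d, (cfg U ⟨x, μ⟩ * φ (x.shift μ) + conj (cfg U ⟨x.unshift μ, μ⟩) * φ (x.unshift μ)))
  linarith

/-! ## §2 The block term: `|(Q_k(u)^*Q_k(u)φ)(x)| ≤ L^{−kd}(Q_k^*Q_k|φ|)(x)` (holonomies have modulus one) -/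

/-- **THE COVARIANT BLOCK TERM IS DOMINATED BY THE FLAT BLOCK AVERAGE OF `|φ|`**: `|(Q_k(u)ᴴQ_k(u)φ)(x)| ≤ L^{−kd}·(Q_k^*Q_k|φ|)(x)`, where
`Q_k^*Q_k` is pv07's flat block-averaging operator (`(Q_k^*Q_ku)(x) = L^{−kd}Σ_{x′∈B^k(x)}u(x′)`) and `Q_k(u)` has the entries
`L^{−kd}u(Γ^{(k)}_{yx})` of (2.6) (`|u(Γ)| = 1`). [cite: BalabanImbrieJaffe1985, (2.6) p.303] -/
theorem norm_gram_qMatK_mulVec_le {k : ℕ} (hk : k ≤ P.m + P.K) (U : GaugeField P 0 U1) (φ : Balaban1983to89.Site P 0 → ℂ)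
    (x : Balaban1983to89.Site P 0) :
    ‖(((qMatK U k univ)ᴴ * qMatK U k univ) *ᵥ φ) x‖ ≤
      ((P.L : ℝ) ^ (k * P.d))⁻¹ * ((B1RG242Torus.Qks P k * B1RG242Torus.Qk P k) *ᵥ fun z => ‖φ z‖) x := by
  rw [← mulVec_mulVec, mulVec, dotProduct, Finset.sum_eq_single (blkIter k x)]
  · rw [conjTranspose_apply, qMatK_apply, if_pos ⟨subset_univ _, mem_blockK_blkIter k x⟩, qMatK_mulVec, if_pos (subset_univ _),
      qCovK_apply, towerQQ_mulVec_apply hk]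
    have hS : univ.filter (fun z' : Balaban1983to89.Site P 0 => Balaban1983to89.Site.proj k k z' = Balaban1983to89.Site.proj k k x) =
        blockK k (blkIter k x) := by
      ext z'
      rw [mem_filter, mem_blockK, BIJ88NeumannPropagatorFlatDecay.blkIter_eq_iff_proj_eq hk, B1RG242Torus.lvl_of_le P hk]
      simp
    rw [hS]
    have hw : (((P.L : ℝ) ^ P.d)⁻¹) ^ k = ((P.L : ℝ) ^ (k * P.d))⁻¹ := by rw [inv_pow, ← pow_mul, Nat.mul_comm P.d k]
    have hn : ‖((P.L : ℂ) ^ (k * P.d))⁻¹‖ = ((P.L : ℝ) ^ (k * P.d))⁻¹ := by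
      rw [norm_inv, norm_pow, Complex.norm_natCast]
    rw [hw, norm_mul, norm_star, norm_mul, norm_mul, hn, norm_holCK U k x, mul_one]
    refine mul_le_mul_of_nonneg_left (mul_le_mul_of_nonneg_left ((norm_sum_le _ _).trans (le_of_eq ?_)) (by positivity))
      (by positivity)
    exact sum_congr rfl fun z _ => by rw [norm_mul, norm_holCK U k z, one_mul]
  · intro y _ hy
    rw [conjTranspose_apply, qMatK_apply, if_neg (fun h => hy (mem_blockK.1 h.2).symm), star_zero, zero_mul]
  · exact fun h => absurd (mem_univ _) h

/-! ## §3 Bookkeeping of the constants: `a/2 ≤ a_k`, the Agmon gap `m₀ − κ(t) ≥ μ₀/(2(L^kε)²)`, and the scalar assembly -/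

/-- kernel: `a/2 ≤ a_k` for `L ≥ 2`, `k ≥ 1` (from `a(1 − L⁻²) < a_k`, (2.15)). [cite: Balaban1982Higgs1, (2.15) p.609] -/
theorem aSeq_ge_half {a : ℝ} (ha : 0 < a) {L : ℝ} (hL : 2 ≤ L) {k : ℕ} (hk : 1 ≤ k) : a / 2 ≤ B1.aSeq a L k := by
  have hL1 : 1 < L := by linarith
  have h := B1.ainf_lt_aSeq ha hL1 k hk
  have hL2 : (L ^ 2)⁻¹ ≤ 1 / 2 := by
    rw [inv_eq_one_div, div_le_div_iff₀ (by positivity) (by norm_num)]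
    nlinarith
  nlinarith [mul_le_mul_of_nonneg_left hL2 ha.le]

/-- kernel (the Agmon gap at our normalization): with p33's mass `m₀ = min(a′/2, c²L^{kd}/(4L^{2k}))/L^{kd}` and conjugation defect
`κ = 2dc²S₁ + a′(S₂/2)L^{−kd}` at `c = ε⁻¹`, `a′ = α_kL^{kd}`, `S₁ = (t/L^k)²e^{t/L^k}`, `S₂ = t²e^t`, for
`0 ≤ t ≤ min(1, μ₀/((4d + a)e))`, `μ₀ = min(a/4, 1/4)`: **`m₀ − κ ≥ μ₀/(2(L^kε)²)`**. [cite: BalabanImbrieJaffe1985, (7.3.2) p.326] -/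
theorem agmon_gap (P : Params) {a : ℝ} (ha : 0 < a) {k : ℕ} (hk1 : 1 ≤ k) {t : ℝ} (ht0 : 0 ≤ t) (ht1 : t ≤ 1)
    (htμ : t ≤ min (a / 4) (1 / 4) / ((4 * P.d + a) * Real.exp 1)) :
    min (a / 4) (1 / 4) / (2 * P.spacing k ^ 2) ≤
      min (B1RG242Torus.α P a k * (P.L : ℝ) ^ (k * P.d) / 2)
          ((P.eps⁻¹) ^ 2 * (P.L : ℝ) ^ (k * P.d) / (4 * ((P.L : ℝ) ^ k) ^ 2)) / (P.L : ℝ) ^ (k * P.d) -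
        (2 * P.d * (P.eps⁻¹) ^ 2 * ((t / (P.L : ℝ) ^ k) ^ 2 * Real.exp (t / (P.L : ℝ) ^ k)) +
          B1RG242Torus.α P a k * (P.L : ℝ) ^ (k * P.d) * (t ^ 2 * Real.exp t / 2 * ((P.L : ℝ) ^ (k * P.d))⁻¹)) := by
  have hL2 : (2 : ℝ) ≤ P.L := by exact_mod_cast P.hL.2
  have hLpos : (0 : ℝ) < P.L := by linarith
  have hL1 : (1 : ℝ) < P.L := by linarith
  have hn : 0 < (P.L : ℝ) ^ k := pow_pos hLpos k
  have hn1 : 1 ≤ (P.L : ℝ) ^ k := one_le_pow₀ hL1.le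
  have hN : 0 < (P.L : ℝ) ^ (k * P.d) := pow_pos hLpos _
  have hε : 0 < P.eps := P.eps_pos
  have hsp : 0 < P.spacing k := P.spacing_pos k
  have hspdef : P.spacing k = (P.L : ℝ) ^ k * P.eps := rfl
  have haS0 : 0 < B1.aSeq a P.L k := B1.aSeq_pos ha hL1 hk1
  have haSle : B1.aSeq a P.L k ≤ a := B1.aSeq_le ha hL1 k hk1
  have haSge : a / 2 ≤ B1.aSeq a P.L k := aSeq_ge_half ha hL2 hk1
  have hd0 : (0 : ℝ) ≤ P.d := Nat.cast_nonneg _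
  rw [show B1RG242Torus.α P a k = B1.aSeq a P.L k * (P.spacing k ^ 2)⁻¹ from rfl]
  set μ₀ : ℝ := min (a / 4) (1 / 4) with hμ₀
  have hμ₀a : μ₀ ≤ a / 4 := min_le_left _ _
  have hμ₀q : μ₀ ≤ 1 / 4 := min_le_right _ _
  have hμ₀pos : 0 < μ₀ := lt_min (by positivity) (by norm_num)
  set sp : ℝ := P.spacing k with hspname
  set n : ℝ := (P.L : ℝ) ^ k with hnname
  set N : ℝ := (P.L : ℝ) ^ (k * P.d) with hNname
  set aS : ℝ := B1.aSeq a P.L k with haSname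
  have hsp2 : 0 < sp ^ 2 := pow_pos hsp 2
  -- (i) the mass from below
  have hm₀ : μ₀ / sp ^ 2 ≤ min (aS * (sp ^ 2)⁻¹ * N / 2) ((P.eps⁻¹) ^ 2 * N / (4 * n ^ 2)) / N := by
    rw [le_div_iff₀ hN, le_min_iff, div_mul_eq_mul_div]
    constructor
    · rw [show aS * (sp ^ 2)⁻¹ * N / 2 = (aS / 2 * N) / sp ^ 2 by ring]
      exact div_le_div_of_nonneg_right (mul_le_mul_of_nonneg_right (by linarith) hN.le) hsp2.le
    · rw [show (P.eps⁻¹) ^ 2 * N / (4 * n ^ 2) = (1 / 4 * N) / sp ^ 2 by rw [hspdef]; field_simp]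
      exact div_le_div_of_nonneg_right (mul_le_mul_of_nonneg_right hμ₀q hN.le) hsp2.le
  -- (ii) the defect from above
  have he1 : Real.exp (t / n) ≤ Real.exp 1 := Real.exp_le_exp.2 ((div_le_self ht0 hn1).trans ht1)
  have he2 : Real.exp t ≤ Real.exp 1 := Real.exp_le_exp.2 ht1
  have ht2 : t ^ 2 ≤ t := by nlinarith
  have hκ1 : 2 * P.d * (P.eps⁻¹) ^ 2 * ((t / n) ^ 2 * Real.exp (t / n)) ≤ 2 * P.d * Real.exp 1 * t / sp ^ 2 := by
    rw [show 2 * P.d * (P.eps⁻¹) ^ 2 * ((t / n) ^ 2 * Real.exp (t / n)) = 2 * P.d * (t ^ 2 * Real.exp (t / n)) / sp ^ 2 by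
      rw [hspdef]; field_simp]
    refine div_le_div_of_nonneg_right ?_ hsp2.le
    have h : t ^ 2 * Real.exp (t / n) ≤ t * Real.exp 1 := mul_le_mul ht2 he1 (Real.exp_pos _).le ht0
    nlinarith [mul_le_mul_of_nonneg_left h (by positivity : (0 : ℝ) ≤ 2 * P.d)]
  have hκ2 : aS * (sp ^ 2)⁻¹ * N * (t ^ 2 * Real.exp t / 2 * N⁻¹) ≤ a * Real.exp 1 * t / 2 / sp ^ 2 := by
    rw [show aS * (sp ^ 2)⁻¹ * N * (t ^ 2 * Real.exp t / 2 * N⁻¹) = aS * (t ^ 2 * Real.exp t) / 2 / sp ^ 2 by field_simp]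
    refine div_le_div_of_nonneg_right (div_le_div_of_nonneg_right ?_ zero_le_two) hsp2.le
    have h : t ^ 2 * Real.exp t ≤ t * Real.exp 1 := mul_le_mul ht2 he2 (Real.exp_pos _).le ht0
    calc aS * (t ^ 2 * Real.exp t) ≤ aS * (t * Real.exp 1) := mul_le_mul_of_nonneg_left h haS0.le
      _ ≤ a * (t * Real.exp 1) := mul_le_mul_of_nonneg_right haSle (by positivity)
      _ = a * Real.exp 1 * t := by ring
  have ht3 : t * (Real.exp 1 * (4 * P.d + a)) ≤ μ₀ := by
    have hpos : 0 < (4 * (P.d : ℝ) + a) * Real.exp 1 := by positivity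
    have h := (le_div_iff₀ hpos).1 htμ
    linarith [h, show t * (Real.exp 1 * (4 * P.d + a)) = t * ((4 * P.d + a) * Real.exp 1) by ring]
  have hκ : 2 * P.d * (P.eps⁻¹) ^ 2 * ((t / n) ^ 2 * Real.exp (t / n)) + aS * (sp ^ 2)⁻¹ * N * (t ^ 2 * Real.exp t / 2 * N⁻¹) ≤
      μ₀ / (2 * sp ^ 2) := by
    calc 2 * P.d * (P.eps⁻¹) ^ 2 * ((t / n) ^ 2 * Real.exp (t / n)) + aS * (sp ^ 2)⁻¹ * N * (t ^ 2 * Real.exp t / 2 * N⁻¹)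
        ≤ 2 * P.d * Real.exp 1 * t / sp ^ 2 + a * Real.exp 1 * t / 2 / sp ^ 2 := add_le_add hκ1 hκ2
      _ = t * (Real.exp 1 * (4 * P.d + a)) / 2 / sp ^ 2 := by ring
      _ ≤ μ₀ / 2 / sp ^ 2 := div_le_div_of_nonneg_right (div_le_div_of_nonneg_right ht3 zero_le_two) hsp2.le
      _ = μ₀ / (2 * sp ^ 2) := by rw [div_div]
  have e : μ₀ / sp ^ 2 - μ₀ / (2 * sp ^ 2) = μ₀ / (2 * sp ^ 2) := by field_simp; ring
  linarith [hm₀, hκ]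

/-- kernel (the scalar assembly of §4): from `|φ(x)|² ≤ W·G₂` (Cauchy–Schwarz), the tilted row bound `W ≤ C₀(L^kε)⁴L^{−kd}`, the split
`G₂ ≤ 3(B + α²A_Q + m²A)`, the block bound `A_Q ≤ e^{2t}A`, the Agmon bound `A ≤ (2(L^kε)²/μ₀)²B`, `α(L^kε)² = a_k ≤ a`, `m(L^kε)² = 1`
and the support bound `B ≤ F²E²KL^{kd}` to `|φ(x)| ≤ √(C₀C₂K)(L^kε)²EF`. [folklore] -/
private theorem assembly_arith {vx W G₂ A A_Q B C₀ sp N F E K α m aS a μ₀ e₂ eₜ : ℝ}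
    (hv2 : vx ^ 2 ≤ W * G₂) (hW : W ≤ C₀ * (sp ^ 4 / N)) (hN : 0 < N) (hC₀ : 0 ≤ C₀)
    (hG₂ : G₂ ≤ 3 * (B + α ^ 2 * A_Q + m ^ 2 * A)) (hG₂nn : 0 ≤ G₂) (hAQ : A_Q ≤ eₜ * A) (heₜ0 : 0 ≤ eₜ) (heₜ : eₜ ≤ e₂)
    (hA : A ≤ (2 * sp ^ 2 / μ₀) ^ 2 * B) (hB0 : 0 ≤ B) (hμ₀ : 0 < μ₀) (hαsp : α * sp ^ 2 = aS) (haS0 : 0 ≤ aS) (haS : aS ≤ a)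
    (hmsp : m * sp ^ 2 = 1) (hB : B ≤ F ^ 2 * E ^ 2 * (K * N)) (hE : 0 ≤ E) (hK : 0 ≤ K) (hF : 0 ≤ F) :
    vx ≤ Real.sqrt (C₀ * (3 * (1 + 4 * (a ^ 2 * e₂ + 1) / μ₀ ^ 2)) * K) * sp ^ 2 * E * F := by
  have he₂ : 0 ≤ e₂ := heₜ0.trans heₜ
  have hae₂ : 0 ≤ a ^ 2 * e₂ := mul_nonneg (sq_nonneg a) he₂
  set C₂ : ℝ := 3 * (1 + 4 * (a ^ 2 * e₂ + 1) / μ₀ ^ 2) with hC₂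
  have hC₂nn : 0 ≤ C₂ := by positivity
  -- `G₂ ≤ C₂B`
  have hcoef : (α ^ 2 * eₜ + m ^ 2) * (2 * sp ^ 2 / μ₀) ^ 2 = 4 * ((α * sp ^ 2) ^ 2 * eₜ + (m * sp ^ 2) ^ 2) / μ₀ ^ 2 := by ring
  rw [hαsp, hmsp, one_pow] at hcoef
  have haS2 : aS ^ 2 * eₜ ≤ a ^ 2 * e₂ :=
    (mul_le_mul_of_nonneg_right (pow_le_pow_left₀ haS0 haS 2) heₜ0).trans (mul_le_mul_of_nonneg_left heₜ (sq_nonneg a))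
  have hcoef_le : (α ^ 2 * eₜ + m ^ 2) * (2 * sp ^ 2 / μ₀) ^ 2 ≤ 4 * (a ^ 2 * e₂ + 1) / μ₀ ^ 2 := by
    rw [hcoef]
    exact div_le_div_of_nonneg_right (by linarith) (sq_nonneg _)
  have hG₂' : G₂ ≤ C₂ * B := by
    have h1 : α ^ 2 * A_Q ≤ α ^ 2 * (eₜ * A) := mul_le_mul_of_nonneg_left hAQ (sq_nonneg _)
    have h2 : (α ^ 2 * eₜ + m ^ 2) * A ≤ (α ^ 2 * eₜ + m ^ 2) * ((2 * sp ^ 2 / μ₀) ^ 2 * B) :=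
      mul_le_mul_of_nonneg_left hA (by positivity)
    have h3 : (α ^ 2 * eₜ + m ^ 2) * (2 * sp ^ 2 / μ₀) ^ 2 * B ≤ 4 * (a ^ 2 * e₂ + 1) / μ₀ ^ 2 * B :=
      mul_le_mul_of_nonneg_right hcoef_le hB0
    calc G₂ ≤ 3 * (B + α ^ 2 * A_Q + m ^ 2 * A) := hG₂
      _ ≤ 3 * (B + (α ^ 2 * eₜ + m ^ 2) * ((2 * sp ^ 2 / μ₀) ^ 2 * B)) := by linarith
      _ = 3 * (B + (α ^ 2 * eₜ + m ^ 2) * (2 * sp ^ 2 / μ₀) ^ 2 * B) := by ring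
      _ ≤ 3 * (B + 4 * (a ^ 2 * e₂ + 1) / μ₀ ^ 2 * B) := by linarith
      _ = C₂ * B := by rw [hC₂]; ring
  -- assemble the squares
  have hsq : vx ^ 2 ≤ (Real.sqrt (C₀ * C₂ * K) * sp ^ 2 * E * F) ^ 2 := by
    have h1 : W * G₂ ≤ C₀ * (sp ^ 4 / N) * (C₂ * B) := mul_le_mul hW hG₂' hG₂nn (by positivity)
    have h2 : C₀ * (sp ^ 4 / N) * (C₂ * B) ≤ C₀ * (sp ^ 4 / N) * (C₂ * (F ^ 2 * E ^ 2 * (K * N))) :=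
      mul_le_mul_of_nonneg_left (mul_le_mul_of_nonneg_left hB hC₂nn) (by positivity)
    have h3 : C₀ * (sp ^ 4 / N) * (C₂ * (F ^ 2 * E ^ 2 * (K * N))) = (Real.sqrt (C₀ * C₂ * K) * sp ^ 2 * E * F) ^ 2 := by
      rw [mul_pow, mul_pow, mul_pow, Real.sq_sqrt (by positivity)]
      field_simp
    linarith
  exact le_of_pow_le_pow_left₀ two_ne_zero (by positivity) hsq


/-! ## §4 The (1.10)-value member at NON-FLAT small fields: `|(G_k(T,u)f)(x)| ≤ c₀(L^kε)²e^{−t₀·dist_∞(x, supp f)/L^k}‖f‖_∞` -/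

/-- **p. 326: THE SUP-NORM DECAY OF THE COVARIANT BLOCK PROPAGATOR `G_k(u)` AT SMALL NON-FLAT FIELDS, `k`-UNIFORM** (the VALUE member
of [Balaban1983RegularityDecay] (1.10) for `G_k(T,u) = [D_u^*D_u + a_kL^{kd}Q_k(u)^*Q_k(u)]⁻¹ = gBox (α_kL^{kd}) ε⁻¹ u k T`, p31's torus
propagator of record; `d ≤ 3`): there are `t₀, c₀ > 0` depending on `d, L, a` only such that for every volume, every `1 ≤ k ≤ K`, every `U(1)`
field with `|u(∂p) − 1| ≤ θ`, `2d³(L^{2k}θ)² ≤ 1`, every `x` and every `f`, `|f| ≤ F`, vanishing at `ℓ^∞`-distance `< D` from `x`: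
`|(G_k(T,u)f)(x)| ≤ c₀(L^kε)²e^{−t₀D/L^k}F`. p. 326: *"we use smallness of the gauge field (7.2.4) to prove … estimates for G_k(Λ₃,u)
… by an extension of the proofs of [7]"* — here by Kato's inequality, the free tilted row bound and p33's weighted `L²` (Agmon) bound.
[cite: BalabanImbrieJaffe1985, (7.3.2) p.326] -/
theorem decay110_smallField (d L : ℕ) (hd : 1 ≤ d) (hd3 : d ≤ 3) (hL : Odd L ∧ 1 < L) {a : ℝ} (ha : 0 < a) :
    ∃ t₀ c₀ : ℝ, 0 < t₀ ∧ 0 < c₀ ∧ ∀ (P : Params), P.d = d → P.L = L →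
      ∀ k : ℕ, 1 ≤ k → k ≤ P.K → ∀ (U : GaugeField P 0 U1) (θ : ℝ),
        (∀ (y : Balaban1983to89.Site P 0) (μ ν : Fin P.d), ‖plaqC U y μ ν - 1‖ ≤ θ) →
        2 * (P.d : ℝ) ^ 3 * (((P.L : ℝ) ^ k) ^ 2 * θ) ^ 2 ≤ 1 →
        ∀ (x : Balaban1983to89.Site P 0) (f : Balaban1983to89.Site P 0 → ℂ) (F D : ℝ),
          (∀ z, ‖f z‖ ≤ F) → (∀ z, f z ≠ 0 → D ≤ (supDist x z : ℝ)) →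
          ‖(gBox (B1RG242Torus.α P a k * (P.L : ℝ) ^ (k * P.d)) P.eps⁻¹ U k univ *ᵥ f) x‖
            ≤ c₀ * P.spacing k ^ 2 * Real.exp (-(t₀ * D / (P.L : ℝ) ^ k)) * F := by
  obtain ⟨t₁, C₀, ht₁, hC₀, hR⟩ := tilted_row_R_sq_le d L hd hd3 hL ha
  set μ₀ : ℝ := min (a / 4) (1 / 4) with hμ₀
  have hμ₀pos : 0 < μ₀ := lt_min (by positivity) (by norm_num)
  set t : ℝ := min (min t₁ 1) (μ₀ / ((4 * d + a) * Real.exp 1)) with htdef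
  have htpos : 0 < t := lt_min (lt_min ht₁ one_pos) (by positivity)
  have ht₁' : t ≤ t₁ := (min_le_left _ _).trans (min_le_left _ _)
  have ht1 : t ≤ 1 := (min_le_left _ _).trans (min_le_right _ _)
  have htμ : t ≤ μ₀ / ((4 * d + a) * Real.exp 1) := min_le_right _ _
  set Kt : ℝ := (2 * (1 + (d : ℝ) / t)) ^ d with hKt
  have hKtpos : 0 < Kt := by positivity
  set C₂ : ℝ := 3 * (1 + 4 * (a ^ 2 * Real.exp 2 + 1) / μ₀ ^ 2) with hC₂
  have hC₂pos : 0 < C₂ := by positivity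
  refine ⟨t / 2, Real.sqrt (C₀ * C₂ * Kt), by positivity, Real.sqrt_pos.2 (by positivity), ?_⟩
  intro P hPd hPL k hk1 hkK U θ hθ hsmall x f F D hF hsupp
  have hRx := hR P hPd hPL k hk1 hkK t htpos.le ht₁' x
  subst hPd
  subst hPL
  -- basic quantities
  have hk : k ≤ P.m + P.K := hkK.trans (Nat.le_add_left _ _)
  have hk0 : 0 + k ≤ P.m + P.K := by omega
  have hLpos : (0 : ℝ) < P.L := P.cast_L_pos
  have hL1 : (1 : ℝ) < P.L := B1RG242Torus.one_lt_cast_L P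
  have hεpos : 0 < P.eps := P.eps_pos
  have hsp : 0 < P.spacing k := P.spacing_pos k
  have hspne : P.spacing k ≠ 0 := hsp.ne'
  have hμ₀ne : μ₀ ≠ 0 := hμ₀pos.ne'
  have hn : 0 < (P.L : ℝ) ^ k := pow_pos hLpos k
  have hN : 0 < (P.L : ℝ) ^ (k * P.d) := pow_pos hLpos _
  have hF0 : 0 ≤ F := (norm_nonneg _).trans (hF x)
  have hα : 0 < B1RG242Torus.α P a k := mul_pos (B1.aSeq_pos ha hL1 hk1) (inv_pos.2 (pow_pos hsp 2))
  have ha' : 0 < B1RG242Torus.α P a k * (P.L : ℝ) ^ (k * P.d) := mul_pos hα hN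
  have hc : P.eps⁻¹ ≠ 0 := inv_ne_zero hεpos.ne'
  have hm : 0 < (P.spacing k ^ 2)⁻¹ := inv_pos.2 (pow_pos hsp 2)
  have hαdef : B1RG242Torus.α P a k = B1.aSeq a P.L k * (P.spacing k ^ 2)⁻¹ := rfl
  -- the objects
  set α₀ : ℝ := B1RG242Torus.α P a k with hα₀
  set m₀ : ℝ := (P.spacing k ^ 2)⁻¹ with hm₀
  set a' : ℝ := α₀ * (P.L : ℝ) ^ (k * P.d) with ha'def
  set φ : Balaban1983to89.Site P 0 → ℂ := gBox a' P.eps⁻¹ U k univ *ᵥ f with hφ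
  set v : Balaban1983to89.Site P 0 → ℝ := fun z => ‖φ z‖ with hv
  set QQ : Matrix (Balaban1983to89.Site P 0) (Balaban1983to89.Site P 0) ℝ := B1RG242Torus.Qks P k * B1RG242Torus.Qk P k with hQQ
  set ω : Balaban1983to89.Site P 0 → ℝ := fun z => Real.exp (-(t * (supDist x z : ℝ) / (P.L : ℝ) ^ k)) with hω
  set w : Balaban1983to89.Site P 0 → ℝ := fun z => Real.exp (t * (supDist x z : ℝ) / (P.L : ℝ) ^ k) with hw
  set R : Matrix (Balaban1983to89.Site P 0) (Balaban1983to89.Site P 0) ℝ := (H P m₀)⁻¹ with hRdef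
  set g : Balaban1983to89.Site P 0 → ℝ := fun z => ‖f z‖ + α₀ * (QQ *ᵥ v) z + m₀ * v z with hg
  have hωpos : ∀ z, 0 < ω z := fun z => Real.exp_pos _
  have hwω : ∀ z, w z * ω z = 1 := fun z => by
    simp only [hw, hω, ← Real.exp_add, add_neg_cancel, Real.exp_zero]
  -- STEP 1: the equation `(D_u^*D_u)φ = f − a′Q_k(u)^*Q_k(u)φ` on the whole torus
  have heq : nOp a' P.eps⁻¹ U k univ *ᵥ φ = f := by
    rw [hφ, mulVec_mulVec, (gBox_univ_mul hk0 hc ha' U).2, one_mulVec]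
  have hDD : ∀ z, (((dN P.eps⁻¹ U univ)ᴴ * dN P.eps⁻¹ U univ) *ᵥ φ) z =
      f z - (a' : ℂ) * (((qMatK U k univ)ᴴ * qMatK U k univ) *ᵥ φ) z := by
    intro z
    have h := congr_fun heq z
    rw [nOp_eq, add_mulVec, smul_mulVec, Pi.add_apply, Pi.smul_apply, smul_eq_mul] at h
    linear_combination h
  -- STEP 2: Kato, `((−Δ^ε + m)|φ|)(z) ≤ g(z)` with `m = (L^kε)⁻²`
  have hKato : ∀ z, (H P m₀ *ᵥ v) z ≤ g z := by
    intro z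
    refine (kato_pointwise hm.le U φ z).trans ?_
    rw [hDD z]
    have hX := norm_gram_qMatK_mulVec_le hk U φ z
    have h1 : ‖(a' : ℂ) * (((qMatK U k univ)ᴴ * qMatK U k univ) *ᵥ φ) z‖ ≤ α₀ * (QQ *ᵥ v) z := by
      rw [norm_mul, Complex.norm_real, Real.norm_of_nonneg ha'.le]
      refine (mul_le_mul_of_nonneg_left hX ha'.le).trans (le_of_eq ?_)
      rw [ha'def, mul_assoc, mul_inv_cancel_left₀ hN.ne']
    have h2 : ‖((m₀ : ℝ) : ℂ) * φ z‖ = m₀ * v z := by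
      rw [norm_mul, Complex.norm_real, Real.norm_of_nonneg hm.le]
    calc ‖f z - (a' : ℂ) * (((qMatK U k univ)ᴴ * qMatK U k univ) *ᵥ φ) z + ((m₀ : ℝ) : ℂ) * φ z‖
        ≤ ‖f z - (a' : ℂ) * (((qMatK U k univ)ᴴ * qMatK U k univ) *ᵥ φ) z‖ + ‖((m₀ : ℝ) : ℂ) * φ z‖ := norm_add_le _ _
      _ ≤ ‖f z‖ + ‖(a' : ℂ) * (((qMatK U k univ)ᴴ * qMatK U k univ) *ᵥ φ) z‖ + ‖((m₀ : ℝ) : ℂ) * φ z‖ :=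
          add_le_add (norm_sub_le _ _) le_rfl
      _ ≤ g z := by rw [h2]; simp only [hg]; linarith [h1]
  -- STEP 3: the comparison principle, `|φ(x)| ≤ (Rg)(x) = Σ_z R(x,z)g(z)`, `R = (−Δ^ε + m)⁻¹ ≥ 0`
  have hvx : v x ≤ ∑ z, R x z * g z := by
    have h := le_inv_H_mulVec hm hKato x
    change v x ≤ ∑ z, R x z * g z at h
    exact h
  -- STEP 4: Cauchy–Schwarz with the weights `w = e^{t|x−z|_∞/L^k}`, `ω = w⁻¹`
  have hCS : (∑ z, R x z * g z) ^ 2 ≤ (∑ z, (w z * R x z) ^ 2) * ∑ z, (ω z * g z) ^ 2 := by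
    have e : ∑ z, R x z * g z = ∑ z, (w z * R x z) * (ω z * g z) :=
      sum_congr rfl fun z _ => by
        rw [show w z * R x z * (ω z * g z) = (w z * ω z) * (R x z * g z) by ring, hwω z, one_mul]
    rw [e]
    exact sum_mul_sq_le_sq_mul_sq _ _ _
  have hv2 : v x ^ 2 ≤ (∑ z, (w z * R x z) ^ 2) * ∑ z, (ω z * g z) ^ 2 :=
    (pow_le_pow_left₀ (norm_nonneg _) hvx 2).trans hCS
  -- STEP 5: the tilted row bound of the free resolvent (§7 of the companion file)
  have hW : ∑ z, (w z * R x z) ^ 2 ≤ C₀ * (P.spacing k ^ 4 / (P.L : ℝ) ^ (k * P.d)) := hRx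
  -- STEP 6: the three pieces of `Σ_z(ω(z)g(z))²`
  set A : ℝ := ∑ z, (ω z * v z) ^ 2 with hA
  set AQ : ℝ := ∑ z, (ω z * (QQ *ᵥ v) z) ^ 2 with hAQ
  set B : ℝ := ∑ z, (ω z * ‖f z‖) ^ 2 with hB
  have hB0 : 0 ≤ B := sum_nonneg fun z _ => sq_nonneg _
  have hG₂ : ∑ z, (ω z * g z) ^ 2 ≤ 3 * (B + α₀ ^ 2 * AQ + m₀ ^ 2 * A) := by
    have h3 : ∀ p q r : ℝ, (p + q + r) ^ 2 ≤ 3 * p ^ 2 + 3 * q ^ 2 + 3 * r ^ 2 := fun p q r => by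
      nlinarith [sq_nonneg (p - q), sq_nonneg (q - r), sq_nonneg (p - r)]
    calc ∑ z, (ω z * g z) ^ 2
        ≤ ∑ z, (3 * (ω z * ‖f z‖) ^ 2 + 3 * α₀ ^ 2 * (ω z * (QQ *ᵥ v) z) ^ 2 + 3 * m₀ ^ 2 * (ω z * v z) ^ 2) :=
          sum_le_sum fun z _ => by
            have e : ω z * g z = ω z * ‖f z‖ + α₀ * (ω z * (QQ *ᵥ v) z) + m₀ * (ω z * v z) := by
              simp only [hg]; ring
            rw [e]
            refine (h3 _ _ _).trans (le_of_eq ?_)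
            ring
      _ = 3 * (B + α₀ ^ 2 * AQ + m₀ ^ 2 * A) := by
          rw [sum_add_distrib, sum_add_distrib, ← mul_sum, ← mul_sum, ← mul_sum, hB, hAQ, hA]
          ring
  -- (6a) the block piece: `A_Q ≤ e^{2t}A`
  have hoscω : ∀ z z' : Balaban1983to89.Site P 0,
      Balaban1983to89.Site.proj k k z' = Balaban1983to89.Site.proj k k z → ω z ≤ Real.exp t * ω z' := by
    intro z z' hzz
    have h1 := weight_block_osc htpos.le hk x z' z hzz.symm
    rw [← Real.exp_add, Real.exp_le_exp] at h1
    show Real.exp _ ≤ Real.exp t * Real.exp _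
    rw [← Real.exp_add, Real.exp_le_exp]
    linarith
  have hAQle : AQ ≤ Real.exp (2 * t) * A := tilted_sq_QQ_le hk hωpos hoscω v
  -- (6b) the source piece: `B ≤ F²e^{−tD/L^k}·K_tL^{kd}`
  have hBle : B ≤ F ^ 2 * Real.exp (-(t / 2 * D / (P.L : ℝ) ^ k)) ^ 2 * (Kt * (P.L : ℝ) ^ (k * P.d)) := by
    have hE : Real.exp (-(t / 2 * D / (P.L : ℝ) ^ k)) ^ 2 = Real.exp (-(t * D / (P.L : ℝ) ^ k)) := by
      rw [sq, ← Real.exp_add]; congr 1; ring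
    rw [hE]
    have hpt : ∀ z, (ω z * ‖f z‖) ^ 2 ≤ F ^ 2 * Real.exp (-(t * D / (P.L : ℝ) ^ k)) * ω z := by
      intro z
      by_cases hz : f z = 0
      · rw [hz, norm_zero, mul_zero, sq, zero_mul]
        exact mul_nonneg (mul_nonneg (sq_nonneg _) (Real.exp_pos _).le) (hωpos z).le
      · have hDz := hsupp z hz
        have hω2 : ω z ^ 2 ≤ Real.exp (-(t * D / (P.L : ℝ) ^ k)) * ω z := by
          show Real.exp _ ^ 2 ≤ Real.exp _ * Real.exp _
          rw [sq, ← Real.exp_add, ← Real.exp_add, Real.exp_le_exp]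
          have : t * D / (P.L : ℝ) ^ k ≤ t * (supDist x z : ℝ) / (P.L : ℝ) ^ k :=
            div_le_div_of_nonneg_right (mul_le_mul_of_nonneg_left hDz htpos.le) hn.le
          linarith
        have hf2 : ‖f z‖ ^ 2 ≤ F ^ 2 := pow_le_pow_left₀ (norm_nonneg _) (hF z) 2
        calc (ω z * ‖f z‖) ^ 2 = ω z ^ 2 * ‖f z‖ ^ 2 := mul_pow _ _ _
          _ ≤ (Real.exp (-(t * D / (P.L : ℝ) ^ k)) * ω z) * F ^ 2 :=
              mul_le_mul hω2 hf2 (sq_nonneg _) (mul_nonneg (Real.exp_pos _).le (hωpos z).le)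
          _ = F ^ 2 * Real.exp (-(t * D / (P.L : ℝ) ^ k)) * ω z := by ring
    have hsumω : ∑ z, ω z ≤ Kt * (P.L : ℝ) ^ (k * P.d) := by
      have h := sum_exp_neg_supDist_scale_le htpos k x
      rw [← pow_mul] at h
      exact h
    calc B = ∑ z, (ω z * ‖f z‖) ^ 2 := hB
      _ ≤ ∑ z, F ^ 2 * Real.exp (-(t * D / (P.L : ℝ) ^ k)) * ω z := sum_le_sum fun z _ => hpt z
      _ = F ^ 2 * Real.exp (-(t * D / (P.L : ℝ) ^ k)) * ∑ z, ω z := by rw [mul_sum]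
      _ ≤ F ^ 2 * Real.exp (-(t * D / (P.L : ℝ) ^ k)) * (Kt * (P.L : ℝ) ^ (k * P.d)) :=
          mul_le_mul_of_nonneg_left hsumω (by positivity)
  -- (6c) the Agmon piece: `A ≤ (2(L^kε)²/μ₀)²B`
  have hAle : A ≤ (2 * P.spacing k ^ 2 / μ₀) ^ 2 * B := by
    -- the bond and block oscillation of `ω`
    have hω₁ : ∀ b : PBond P 0, (ω b.tgt - ω b.src) ^ 2 ≤
        ((t / (P.L : ℝ) ^ k) ^ 2 * Real.exp (t / (P.L : ℝ) ^ k)) * (ω b.tgt * ω b.src) := by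
      intro b
      refine sq_exp_sub_exp_le_of_abs_le ?_
      have h1 := abs_supDist_shift_sub_le x b.src b.dir
      rw [show -(t * (supDist x b.tgt : ℝ) / (P.L : ℝ) ^ k) - -(t * (supDist x b.src : ℝ) / (P.L : ℝ) ^ k) =
          -(t / (P.L : ℝ) ^ k) * ((supDist x (b.src.shift b.dir) : ℝ) - supDist x b.src) from by
            rw [show b.tgt = b.src.shift b.dir from rfl]; ring,
        abs_mul, abs_neg, abs_of_nonneg (div_nonneg htpos.le hn.le)]
      exact mul_le_of_le_one_right (div_nonneg htpos.le hn.le) h1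
    have hω₂ : ∀ z z' : Balaban1983to89.Site P 0, blkIter k z = blkIter k z' →
        (ω z - ω z') ^ 2 ≤ (t ^ 2 * Real.exp t) * (ω z * ω z') := by
      intro z z' hzz
      refine sq_exp_sub_exp_le_of_abs_le ?_
      have hd1 : supDist z z' ≤ P.L ^ k := (BIJ85ScalarPropagatorDecay.supDist_le_of_blkIter_eq hk0 hzz).trans (Nat.sub_le _ _)
      have htri1 : supDist x z ≤ supDist x z' + supDist z' z := BIJ85Ineq722Torus.supDist_triangle x z' z
      have htri2 : supDist x z' ≤ supDist x z + supDist z z' := BIJ85Ineq722Torus.supDist_triangle x z z'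
      rw [B3TorusRadialSums.supDist_comm z' z] at htri1
      have habs : |(supDist x z : ℝ) - supDist x z'| ≤ (P.L : ℝ) ^ k := by
        have c1 : ((supDist x z : ℕ) : ℝ) ≤ (supDist x z' : ℕ) + (supDist z z' : ℕ) := by exact_mod_cast htri1
        have c2 : ((supDist x z' : ℕ) : ℝ) ≤ (supDist x z : ℕ) + (supDist z z' : ℕ) := by exact_mod_cast htri2
        have c3 : ((supDist z z' : ℕ) : ℝ) ≤ (P.L : ℝ) ^ k := by exact_mod_cast hd1
        rw [abs_sub_le_iff]; constructor <;> linarith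
      rw [show -(t * (supDist x z : ℝ) / (P.L : ℝ) ^ k) - -(t * (supDist x z' : ℝ) / (P.L : ℝ) ^ k) =
          -(t / (P.L : ℝ) ^ k) * ((supDist x z : ℝ) - supDist x z') by ring,
        abs_mul, abs_neg, abs_of_nonneg (div_nonneg htpos.le hn.le)]
      calc t / (P.L : ℝ) ^ k * |(supDist x z : ℝ) - supDist x z'| ≤ t / (P.L : ℝ) ^ k * (P.L : ℝ) ^ k :=
            mul_le_mul_of_nonneg_left habs (div_nonneg htpos.le hn.le)
        _ = t := div_mul_cancel₀ t hn.ne'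
    -- the gap `m₀ − κ ≥ μ₀/(2(L^kε)²)` (§3)
    have hge := agmon_gap P ha hk1 htpos.le ht1 htμ
    have hν : 0 < μ₀ / (2 * P.spacing k ^ 2) := by positivity
    have hκ := sub_pos.1 (lt_of_lt_of_le hν hge)
    -- p33's weighted `L²` bound for the inverse `gLin = gBox·` of p11's operator
    set fL : FineSp P 0 := WithLp.toLp 2 f with hfL
    have hAg := BIJ85ScalarPropagatorDecay.agmon_weighted hk0 P.eps⁻¹ ha' U hθ hsmall (ω := ω)
      (S₁ := (t / (P.L : ℝ) ^ k) ^ 2 * Real.exp (t / (P.L : ℝ) ^ k)) (S₂ := t ^ 2 * Real.exp t)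
      (by positivity) (by positivity) hω₁ hω₂ hκ (G := gLin a' P.eps⁻¹ U k) (fun ψ => (opT_gLin hk0 hc ha' U ψ).1) fL
    have hAg' : ‖wmul ω (gLin a' P.eps⁻¹ U k fL)‖ ≤ ‖wmul ω fL‖ / (μ₀ / (2 * P.spacing k ^ 2)) :=
      hAg.trans (div_le_div_of_nonneg_left (norm_nonneg _) hν hge)
    have hGz : ∀ z, (gLin a' P.eps⁻¹ U k fL) z = φ z := fun z => by
      show (WithLp.ofLp (gLin a' P.eps⁻¹ U k fL)) z = φ z
      rw [ofLp_gLin, hfL, WithLp.ofLp_toLp]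
    have hAeq : ‖wmul ω (gLin a' P.eps⁻¹ U k fL)‖ ^ 2 = A := by
      rw [norm_wmul_sq, hA]
      exact sum_congr rfl fun z _ => by rw [hGz z]
    have hBeq : ‖wmul ω fL‖ ^ 2 = B := by
      rw [norm_wmul_sq, hB]
    have h := pow_le_pow_left₀ (norm_nonneg _) hAg' 2
    rw [hAeq, div_pow, hBeq] at h
    refine h.trans (le_of_eq ?_)
    field_simp
  -- STEP 7: the scalar assembly (§3)
  have hαsp : α₀ * P.spacing k ^ 2 = B1.aSeq a P.L k := by
    rw [hαdef, inv_mul_cancel_right₀ (pow_pos hsp 2).ne']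
  have hmsp : m₀ * P.spacing k ^ 2 = 1 := inv_mul_cancel₀ (pow_pos hsp 2).ne'
  have he2t : Real.exp (2 * t) ≤ Real.exp 2 := Real.exp_le_exp.2 (by linarith)
  exact assembly_arith hv2 hW hN hC₀.le hG₂ (sum_nonneg fun z _ => sq_nonneg _) hAQle (Real.exp_pos _).le he2t hAle hB0 hμ₀pos
    hαsp (B1.aSeq_pos ha hL1 hk1).le (B1.aSeq_le ha hL1 k hk1) hmsp hBle (Real.exp_pos _).le hKtpos.le hF0

/-- **THE SAME BOUND IN p31's (1.10) SHAPE** (distance `B5Ineq137Torus.T = |·−·|_∞`, rate `e^{−δ₀εD}`; `(L^kε)² ≤ 1` and `ε ≤ L^{−k}` for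
`k ≤ K`): the non-flat small-field companion of `BIJ88NeumannPropagatorFlatDecay.decay110_flat` (value member).
[cite: BalabanImbrieJaffe1985, (7.3.2) p.326] -/
theorem decay110_smallField_T (d L : ℕ) (hd : 1 ≤ d) (hd3 : d ≤ 3) (hL : Odd L ∧ 1 < L) {a : ℝ} (ha : 0 < a) :
    ∃ δ₀ c₀ : ℝ, 0 < δ₀ ∧ 0 < c₀ ∧ ∀ (P : Params), P.d = d → P.L = L →
      ∀ k : ℕ, 1 ≤ k → k ≤ P.K → ∀ (U : GaugeField P 0 U1) (θ : ℝ),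
        (∀ (y : Balaban1983to89.Site P 0) (μ ν : Fin P.d), ‖plaqC U y μ ν - 1‖ ≤ θ) →
        2 * (P.d : ℝ) ^ 3 * (((P.L : ℝ) ^ k) ^ 2 * θ) ^ 2 ≤ 1 →
        ∀ (x : Balaban1983to89.Site P 0) (f : Balaban1983to89.Site P 0 → ℂ) (F D : ℝ),
          (∀ z, ‖f z‖ ≤ F) → 0 ≤ D → (∀ z, f z ≠ 0 → D ≤ B5Ineq137Torus.T P 0 x z) →
          ‖(gBox (B1RG242Torus.α P a k * (P.L : ℝ) ^ (k * P.d)) P.eps⁻¹ U k univ *ᵥ f) x‖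
            ≤ c₀ * Real.exp (-(δ₀ * (P.eps * D))) * F := by
  obtain ⟨t₀, c₀, ht₀, hc₀, hmain⟩ := decay110_smallField d L hd hd3 hL ha
  refine ⟨t₀, c₀, ht₀, hc₀, fun P hPd hPL k hk1 hkK U θ hθ hsmall x f F D hF hD hsupp => ?_⟩
  have h := hmain P hPd hPL k hk1 hkK U θ hθ hsmall x f F D hF
    (fun z hz => by rw [← B3Bound323ZeroTorus.T_eq_supDist]; exact hsupp z hz)
  have hF0 : 0 ≤ F := (norm_nonneg _).trans (hF x)
  have hsp1 : (P.L : ℝ) ^ k * P.eps ≤ 1 := B3GkZeroTorusRescaled.spacing_le_one P hkK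
  have hsp0 : 0 < P.spacing k := P.spacing_pos k
  have hn : 0 < (P.L : ℝ) ^ k := pow_pos P.cast_L_pos k
  have h1 : P.spacing k ^ 2 ≤ 1 := pow_le_one₀ hsp0.le hsp1
  have hexp : Real.exp (-(t₀ * D / (P.L : ℝ) ^ k)) ≤ Real.exp (-(t₀ * (P.eps * D))) := by
    rw [Real.exp_le_exp, neg_le_neg_iff, le_div_iff₀ hn]
    nlinarith [mul_nonneg ht₀.le hD, P.eps_pos.le]
  calc _ ≤ c₀ * P.spacing k ^ 2 * Real.exp (-(t₀ * D / (P.L : ℝ) ^ k)) * F := h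
    _ ≤ c₀ * 1 * Real.exp (-(t₀ * (P.eps * D))) * F :=
        mul_le_mul_of_nonneg_right
          (mul_le_mul (mul_le_mul_of_nonneg_left h1 hc₀.le) hexp (Real.exp_pos _).le (by positivity)) hF0
    _ = c₀ * Real.exp (-(t₀ * (P.eps * D))) * F := by rw [mul_one]

/-- **KERNEL FORM**: `|G_k(T,u)(x,y)| ≤ c₀(L^kε)²e^{−t₀|x−y|_∞/L^k}` at small non-flat fields, `k`-uniform (`d ≤ 3`).
[cite: BalabanImbrieJaffe1985, (7.3.2) p.326] -/
theorem decay110_smallField_kernel (d L : ℕ) (hd : 1 ≤ d) (hd3 : d ≤ 3) (hL : Odd L ∧ 1 < L) {a : ℝ} (ha : 0 < a) :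
    ∃ t₀ c₀ : ℝ, 0 < t₀ ∧ 0 < c₀ ∧ ∀ (P : Params), P.d = d → P.L = L →
      ∀ k : ℕ, 1 ≤ k → k ≤ P.K → ∀ (U : GaugeField P 0 U1) (θ : ℝ),
        (∀ (y : Balaban1983to89.Site P 0) (μ ν : Fin P.d), ‖plaqC U y μ ν - 1‖ ≤ θ) →
        2 * (P.d : ℝ) ^ 3 * (((P.L : ℝ) ^ k) ^ 2 * θ) ^ 2 ≤ 1 →
        ∀ x y : Balaban1983to89.Site P 0,
          ‖gBox (B1RG242Torus.α P a k * (P.L : ℝ) ^ (k * P.d)) P.eps⁻¹ U k univ x y‖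
            ≤ c₀ * P.spacing k ^ 2 * Real.exp (-(t₀ * (supDist x y : ℝ) / (P.L : ℝ) ^ k)) := by
  obtain ⟨t₀, c₀, ht₀, hc₀, hmain⟩ := decay110_smallField d L hd hd3 hL ha
  refine ⟨t₀, c₀, ht₀, hc₀, fun P hPd hPL k hk1 hkK U θ hθ hsmall x y => ?_⟩
  have h := hmain P hPd hPL k hk1 hkK U θ hθ hsmall x (Pi.single y 1) 1 (supDist x y : ℝ)
    (fun z => by by_cases hz : z = y <;> simp [hz]) (fun z hz => by
      by_cases hzy : z = y
      · rw [hzy]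
      · exact absurd (by simp [hzy]) hz)
  rwa [mulVec_single_one, col_apply, mul_one] at h


/-! ## §5 (v1.1) p31's displayed hypothesis (H1.10) of `BIJ88DeltaLocClose235General` for the OUTER REGION `X = T` (the whole torus) -/

/-- **(H1.10) AT `X = T` (THE WHOLE TORUS), NON-FLAT SMALL `u` — IN THE BINDER SHAPE CONSUMED BY p31's `BIJ88DeltaLocClose235General`**
(`opClose231_of_inputs` / `close235_of_inputs` / `ineq238_of_inputs` / `Z49_of_inputs` take it for the outer region as `hGΩ`:
`∀ x f F D, (∀ y, ‖f y‖ ≤ F) → (∀ y, f y ≠ 0 → D ≤ T(x,y)) → ‖(G_k(T,u)f)(x)‖ ≤ (L^kε)²·(c₀e^{−δ₀D/L^k}F)`): the theorem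
`decay110_smallField` with `T(x,y) = |x − y|_∞` (`B3Bound323ZeroTorus.T_eq_supDist`) and the factors reordered; hypotheses as there
(`1 ≤ d ≤ 3`, odd `L > 1`, `1 ≤ k ≤ K`, plaquettes within `θ` of `1` with `2d³(L^{2k}θ)² ≤ 1` — uniform in the volume).
[cite: Balaban1983RegularityDecay, (1.10) p.573] -/
theorem decay110_smallField_input (d L : ℕ) (hd : 1 ≤ d) (hd3 : d ≤ 3) (hL : Odd L ∧ 1 < L) {a : ℝ} (ha : 0 < a) :
    ∃ δ₀ c₀ : ℝ, 0 < δ₀ ∧ 0 < c₀ ∧ ∀ (P : Params), P.d = d → P.L = L →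
      ∀ k : ℕ, 1 ≤ k → k ≤ P.K → ∀ (U : GaugeField P 0 U1) (θ : ℝ),
        (∀ (y : Balaban1983to89.Site P 0) (μ ν : Fin P.d), ‖plaqC U y μ ν - 1‖ ≤ θ) →
        2 * (P.d : ℝ) ^ 3 * (((P.L : ℝ) ^ k) ^ 2 * θ) ^ 2 ≤ 1 →
        ∀ (x : Balaban1983to89.Site P 0) (f : Balaban1983to89.Site P 0 → ℂ) (F D : ℝ), (∀ y, ‖f y‖ ≤ F) →
          (∀ y, f y ≠ 0 → D ≤ B5Ineq137Torus.T P 0 x y) →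
          ‖(gBox (B1RG242Torus.α P a k * (P.L : ℝ) ^ (k * P.d)) P.eps⁻¹ U k univ *ᵥ f) x‖
            ≤ P.spacing k ^ 2 * (c₀ * Real.exp (-(δ₀ * (((P.L : ℝ) ^ k)⁻¹ * D))) * F) := by
  obtain ⟨t₀, c₀, ht₀, hc₀, hmain⟩ := decay110_smallField d L hd hd3 hL ha
  refine ⟨t₀, c₀, ht₀, hc₀, fun P hPd hPL k hk1 hkK U θ hθ hsmall x f F D hF hsupp => ?_⟩
  have h := hmain P hPd hPL k hk1 hkK U θ hθ hsmall x f F D hF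
    (fun z hz => by rw [← B3Bound323ZeroTorus.T_eq_supDist]; exact hsupp z hz)
  have e : t₀ * D / (P.L : ℝ) ^ k = t₀ * (((P.L : ℝ) ^ k)⁻¹ * D) := by rw [div_eq_mul_inv]; ring
  rw [e] at h
  calc _ ≤ _ := h
    _ = _ := by ring

end

end Literature.MathematicalPhysics.QuantumFieldTheory.BalabanImbrieJaffe1984to88.BIJ85ScalarPropagatorSupDecay
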